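import Mathlib
import Literature.Barriers.PneNP.TSPExtensionComplexity
import Literature.Barriers.PneNP.TSPExtensionComplexityFaces
import HarnessLib

/-!
# Linear (and affine) images of extended formulations are free

The tree measures extension complexity in the slack-form currency of Fiorini–Massar–Pokutta–Tiwary–
de Wolf (`Literature.Barriers.PneNP.HasEFOfSize P r`, `TSPExtensionComplexity.lean`): `P ⊆ ℝ^ι` has an
EF of size `r` if `P = {x | ∃ y ∈ ℝ^r, y ≥ 0, E x + F y = g}` for some equality system — the natural
variables `x` are free, only the `r` extra variables are sign-constrained, and the number of equations is
not counted.  In this currency the first half of FMPTW's Lemma 9 — "if `F` is an extension of `P`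
(i.e. `P = π(F)` for a linear map `π`), then `xc(F) ≥ xc(P)`", equivalently Avis–Tiwary's Proposition 1
"If `P` is a projection of `Q` then `xc(P) ≤ xc(Q)`" — holds EXACTLY, with no additive loss:

* `HasEFOfSize.image_linearMap : HasEFOfSize P r → HasEFOfSize (L '' P) r` for every linear
  `L : ℝ^ι → ℝ^κ`;
* `HasEFOfSize.image_add_const`, `HasEFOfSize.image_affine` — translations and affine maps
  (Grochow's definition of an extension uses affine linear maps);
* `HasEFOfSize.image_comp'` — coordinate projections / re-indexings `x ↦ x ∘ f`, the lossless form of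
  `HasEFOfSize.image_comp` of `TSPExtensionComplexityFaces.lean` (which charges `+|ι|` and needs
  `P ≥ 0`; it and `HasEFOfSize.image_linear` of the Grochow file stay as they are);
* `HasEFOfSize.image_linearEquiv_iff` — invariance under linear changes of coordinates.

Together with `HasEFOfSize.inter_eqs` (faces cut out by equations are free, same file) this is the
complete "projection of a face" toolkit used by FMPTW (Lemma 9), Avis–Tiwary (Prop. 1/2, Lemmas 3–5,
Thms. 12–13) and Grochow (Lemma 3.1: `xc(New f) ≤ c(New g)`).

## Proof

Write `P = {x | ∃ y ≥ 0, E x + F y = g}`.  Then `z ∈ L(P)` iff `∃ y ≥ 0 ∃ x, E x = g - F y ∧ L x = z`.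
The inner condition says that `(g - F y, z)` lies in the range of the linear map `A x := (E x, L x)`,
and the range of a linear map into a finite-dimensional space is the kernel of a linear map
`N : ℝ^k × ℝ^κ → ℝ^d` (`exists_kerMap`: compose the quotient map by `range A` with a coordinate
isomorphism of the quotient) — Gaussian elimination of the free unknowns `x`, done basis-free.  Hence
`z ∈ L(P)` iff `∃ y ≥ 0, N(0, z) - N(F y, 0) = -N(g, 0)`, a slack-form system in `(z, y)` with the same
`r` sign-constrained variables, and `hasEFOfSize_of_system` re-indexes its rows by `Fin`.

No new definition, no named fact; Mathlib linear algebra only.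

## References

* S. Fiorini, S. Massar, S. Pokutta, H. R. Tiwary, R. de Wolf, *Exponential lower bounds for polytopes
  in combinatorial optimization*, J. ACM 62 (2015), art. 17 = arXiv:1111.0837; §2 ("an extension of `P`
  is a polytope `Q ⊆ ℝ^e` such that there is a linear map `π : ℝ^e → ℝ^d` with `π(Q) = P`", p. 8;
  slack-form EFs and their size, p. 8), Lemma 9 (i) (p. 10: "if `F` is an extension of `P`, then
  `xc(F) ≥ xc(P)` … obvious because every extension of `F` is in particular an extension of `P`").
  Bib key `FioriniEtAl2015`.
* D. Avis, H. R. Tiwary, *On the extension complexity of combinatorial polytopes*, Math. Program. 153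
  (2015), 95–115 = arXiv:1302.2340; §2.2 (EF `E x + F y = g, y ≥ 0`, size = number of inequalities,
  p. 5), Proposition 1 (p. 6: "If `P` is a projection of `Q` then `xc(P) ≤ xc(Q)`"), Lemma 3 (p. 12).
  Bib key `AvisTiwary2015`.
* J. A. Grochow, *Monotone projection lower bounds from extended formulation lower bounds*, Theory of
  Computing 13 (2017), art. 18 = arXiv:1510.08417; §2 (extension along an affine linear map, p. 5).
  Bib key `Grochow2017`.
-/

noncomputable section

namespace Literature.Barriers.PneNP

open Matrix

variable {ι : Type} [Fintype ι] {r : ℕ}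

/-- Linear-algebra core (elimination of free unknowns): for a linear map `A : V → W` into a
finite-dimensional real vector space there is a linear `N : W → ℝ^d` whose kernel is the range of `A`,
i.e. the system `A x = w` is solvable in `x` iff `N w = 0` (take `N` = a coordinate isomorphism of
`W ⧸ range A` composed with the quotient map). [folklore] -/
private theorem exists_kerMap {V W : Type} [AddCommGroup V] [Module ℝ V] [AddCommGroup W] [Module ℝ W]
    [FiniteDimensional ℝ W] (A : V →ₗ[ℝ] W) :
    ∃ (d : ℕ) (N : W →ₗ[ℝ] (Fin d → ℝ)), ∀ w, (∃ x, A x = w) ↔ N w = 0 := by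
  let R := LinearMap.range A
  let b := Module.finBasis ℝ (W ⧸ R)
  refine ⟨_, b.equivFun.toLinearMap ∘ₗ R.mkQ, fun w => ?_⟩
  simp only [LinearMap.coe_comp, LinearEquiv.coe_coe, Function.comp_apply,
    LinearEquiv.map_eq_zero_iff, Submodule.mkQ_apply, Submodule.Quotient.mk_eq_zero, R,
    LinearMap.mem_range]

/-- **Linear images keep the size of a slack-form EF** — FMPTW Lemma 9 (i) "if `F` is an extension of
`P`, then `xc(F) ≥ xc(P)`" / Avis–Tiwary Prop. 1 "If `P` is a projection of `Q` then `xc(P) ≤ xc(Q)`",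
in the tree's currency `HasEFOfSize` (slack form `E x + F y = g, y ≥ 0`, size = number `r` of
sign-constrained variables, natural variables free): if `HasEFOfSize P r` and `L : ℝ^ι → ℝ^κ` is linear
then `HasEFOfSize (L '' P) r`, with NO additive loss and no hypothesis on `P`.  Proof: the old natural
variables `x` become free unknowns of `{(z, y) | ∃ x, E x = g - F y ∧ L x = z}`; solvability in `x` is
the linear condition `N (g - F y, z) = 0` of `exists_kerMap` for `A x = (E x, L x)`, i.e. again an
equality system `E' z + F' y = g'` in `(z, y)` with the same `r` slack variables `y ≥ 0`
(`hasEFOfSize_of_system`).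
[cite: FioriniEtAl2015, Lemma 9 (i) (arXiv:1111.0837 p. 10) with §2 (extension = linear image, p. 8)]
[cite: AvisTiwary2015, Proposition 1 (arXiv:1302.2340 p. 6)] -/
theorem HasEFOfSize.image_linearMap {P : Set (ι → ℝ)} (h : HasEFOfSize P r) {κ : Type} [Fintype κ]
    (L : (ι → ℝ) →ₗ[ℝ] (κ → ℝ)) : HasEFOfSize (L '' P) r := by
  classical
  obtain ⟨Q, hQ⟩ := h
  -- `A x = (E x, L x)`
  obtain ⟨d, N, hN⟩ := exists_kerMap (LinearMap.prod Q.E.mulVecLin L)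
  -- the new system in `(z, y)`: `N (0, z) - N (F y, 0) = - N (g, 0)`
  let E' : Matrix (Fin d) κ ℝ := LinearMap.toMatrix' (N ∘ₗ LinearMap.inr ℝ (Fin Q.k → ℝ) (κ → ℝ))
  let F' : Matrix (Fin d) (Fin r) ℝ :=
    -LinearMap.toMatrix' (N ∘ₗ LinearMap.inl ℝ (Fin Q.k → ℝ) (κ → ℝ) ∘ₗ Q.F.mulVecLin)
  let g' : Fin d → ℝ := -N (Q.g, 0)
  have hE' : ∀ z : κ → ℝ, E' *ᵥ z = N (0, z) := by
    intro z; simp [E', LinearMap.toMatrix'_mulVec]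
  have hF' : ∀ y : Fin r → ℝ, F' *ᵥ y = -N (Q.F *ᵥ y, 0) := by
    intro y; simp [F', Matrix.neg_mulVec, LinearMap.toMatrix'_mulVec]
  have h0 := hasEFOfSize_of_system (ι := κ) E' F' g'
  rw [Fintype.card_fin] at h0
  convert h0 using 1
  ext z
  simp only [Set.mem_image, Set.mem_setOf_eq]
  constructor
  · rintro ⟨x, hxP, rfl⟩
    obtain ⟨y, hy, hsys⟩ : x ∈ Q.projSet := by rw [hQ]; exact hxP
    refine ⟨y, hy, ?_⟩
    have hmem : N (Q.g - Q.F *ᵥ y, L x) = 0 := by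
      rw [← (hN _).1 ⟨x, ?_⟩]
      rw [LinearMap.prod_apply]
      show (Q.E *ᵥ x, L x) = (Q.g - Q.F *ᵥ y, L x)
      rw [← hsys, add_sub_cancel_right]
    rw [hE', hF']
    have : N (Q.g - Q.F *ᵥ y, L x) = N (Q.g, 0) - N (Q.F *ᵥ y, 0) + N (0, L x) := by
      rw [← map_sub, ← map_add]; congr 1; ext <;> simp
    rw [this] at hmem
    show N (0, L x) + -N (Q.F *ᵥ y, 0) = -N (Q.g, 0)
    linear_combination hmem
  · rintro ⟨y, hy, hsys⟩
    rw [hE', hF'] at hsys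
    have hmem : N (Q.g - Q.F *ᵥ y, z) = 0 := by
      have : N (Q.g - Q.F *ᵥ y, z) = N (Q.g, 0) - N (Q.F *ᵥ y, 0) + N (0, z) := by
        rw [← map_sub, ← map_add]; congr 1; ext <;> simp
      rw [this]
      have hsys' : N (0, z) + -N (Q.F *ᵥ y, 0) = -N (Q.g, 0) := hsys
      linear_combination hsys'
    obtain ⟨x, hx⟩ := (hN _).2 hmem
    rw [LinearMap.prod_apply] at hx
    change (Q.E *ᵥ x, L x) = (Q.g - Q.F *ᵥ y, z) at hx
    simp only [Prod.mk.injEq] at hx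
    refine ⟨x, ?_, hx.2⟩
    rw [← hQ]
    exact ⟨y, hy, by rw [hx.1, sub_add_cancel]⟩

/-- **Translations keep the size**: `HasEFOfSize P r → HasEFOfSize (P + v) r` (replace the right-hand
side `g` by `g + E v`).  With `image_linearMap` this covers the AFFINE linear maps of Grochow's definition
of an extension ("an affine linear map `ℓ : ℝ^m → ℝⁿ` such that `ℓ(Q) = P`").
[cite: Grochow2017, §2, definition of extension (arXiv:1510.08417 p. 5)] -/
theorem HasEFOfSize.image_add_const {P : Set (ι → ℝ)} (h : HasEFOfSize P r) (v : ι → ℝ) :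
    HasEFOfSize ((fun x => x + v) '' P) r := by
  obtain ⟨Q, hQ⟩ := h
  refine ⟨⟨Q.k, Q.E, Q.F, Q.g + Q.E *ᵥ v⟩, ?_⟩
  ext z
  simp only [ExtendedFormulation.projSet, Set.mem_setOf_eq, Set.mem_image]
  constructor
  · rintro ⟨y, hy, hsys⟩
    refine ⟨z - v, ?_, sub_add_cancel z v⟩
    rw [← hQ]
    refine ⟨y, hy, ?_⟩
    rw [Matrix.mulVec_sub]
    have := hsys
    linear_combination (norm := skip) this
    abel
  · rintro ⟨x, hxP, rfl⟩
    obtain ⟨y, hy, hsys⟩ : x ∈ Q.projSet := by rw [hQ]; exact hxP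
    refine ⟨y, hy, ?_⟩
    rw [Matrix.mulVec_add, ← hsys]
    abel

/-- **Affine images keep the size**: `HasEFOfSize P r → HasEFOfSize ((L · + v) '' P) r` for linear `L`
and a vector `v` — Grochow's "extension along an affine linear map" costs nothing in slack form.
[cite: Grochow2017, §2, definition of extension (arXiv:1510.08417 p. 5)]
[cite: FioriniEtAl2015, Lemma 9 (i) (arXiv:1111.0837 p. 10)] -/
theorem HasEFOfSize.image_affine {P : Set (ι → ℝ)} (h : HasEFOfSize P r) {κ : Type} [Fintype κ]
    (L : (ι → ℝ) →ₗ[ℝ] (κ → ℝ)) (v : κ → ℝ) : HasEFOfSize ((fun x => L x + v) '' P) r := by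
  have := (h.image_linearMap L).image_add_const v
  rwa [Set.image_image] at this

/-- **Coordinate projections / re-indexings keep the size** — the lossless form of
`HasEFOfSize.image_comp` (`TSPExtensionComplexityFaces.lean`: `+|ι|` and `P ≥ 0` required there): for
any `f : κ → ι` the image of `P` under `x ↦ x ∘ f` (drop the coordinates outside the range of `f`,
duplicate those hit twice) has an EF of the same size `r`.  This is the step "`CUT□(H)` is a projection
of `CUT□(G)`" of Avis–Tiwary's Lemmas 3–5 (edge deletion / contraction) in exact form.
[cite: AvisTiwary2015, Proposition 1 and Lemma 3 (arXiv:1302.2340 pp. 6, 12)]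
[cite: FioriniEtAl2015, Lemma 9 (i) (arXiv:1111.0837 p. 10)] -/
theorem HasEFOfSize.image_comp' {P : Set (ι → ℝ)} (h : HasEFOfSize P r) {κ : Type} [Fintype κ]
    (f : κ → ι) : HasEFOfSize ((fun x : ι → ℝ => x ∘ f) '' P) r :=
  h.image_linearMap (LinearMap.funLeft ℝ ℝ f)

/-- **Linear changes of coordinates keep the size** in both directions (apply `image_linearMap` to `e`
and to `e.symm`). [cite: FioriniEtAl2015, Lemma 9 (i) (arXiv:1111.0837 p. 10)] -/
theorem HasEFOfSize.image_linearEquiv_iff {P : Set (ι → ℝ)} {κ : Type} [Fintype κ]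
    (e : (ι → ℝ) ≃ₗ[ℝ] (κ → ℝ)) : HasEFOfSize (e '' P) r ↔ HasEFOfSize P r := by
  refine ⟨fun h => ?_, fun h => h.image_linearMap e.toLinearMap⟩
  have := h.image_linearMap e.symm.toLinearMap
  rwa [Set.image_image, show (fun x => e.symm.toLinearMap (e x)) = id from
    funext fun x => e.symm_apply_apply x, Set.image_id] at this

end Literature.Barriers.PneNP

end
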